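import Summits.BirchSwinnertonDyer.Rank1Residual.Additive.KobayashiTowerGeneration
import Mathlib.Topology.Algebra.Module.FiniteDimension
import HarnessLib

/-!
# Layer descent by the logarithm: a subgroup of `E₁(k_m)` that is `p`-divisible modulo `E₁(k_{m'})`
# lies in `E₁(k_{m'})`; test points with prescribed logarithm (cell `b2b-bsdres`, CLASS-CLOSURE
# lane, class O10 — x1b GEN 40, class lead; file 87 of the series)

HONEST FRAMING (cell `b2b-bsdres`, run/shared/lean/b2b/bsd-rank1-residual/, verbatim in every
file): the goal of the cell is to DELETE the COMBINATION-SHAPED residual classes of the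
Birch–Swinnerton-Dyer formula for ALL analytic-rank `≤ 1` elliptic curves over `ℚ` — "full BSD
formula for every rank `≤ 1` curve in class `C`" assembled STRICTLY from published theorems — so
that the rank-`≤ 1` remainder becomes exactly the CONSTRUCTION-SHAPED classes, which are TYPED
(missing-input `Prop`s), NOT attempted. This is not "finishing BSD". CLASS-CLOSURE lane: prove
what is provable now; shrink each hard class to its core with data; no claim beyond stated classes;
research routes on CONSTRUCTION-SHAPED X12 / O10; census / instrument output = EVIDENCE / conjecture
items, NEVER a Literature fact; `RESIDUAL-MAP.md` marks change only by signed lines. THIS FILE: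
TOOL THEOREMS ONLY — no definition, no named Literature fact, no `sorry`, axioms standard; nothing
is booked; no label / mark / count / sub-cell moves; (C1_η), (C2_η-GZ), (C3_η) stay typed as filed
(cc-typer-6's pen); nothing about `BSD(W, p)` of any pair is claimed.

## What (`Ω = ℚ̄_p`, `E_Ω = (M ⊗ ℚ_p) ⊗ Ω`, `L(m)` = points with coordinates in `layer p m =
## ℚ_p(ζ_{p^m})`, `E₁ = kernel` of reduction, `Λ = ptLogΩ`)

The ONE mathematical input left in brick B3's corank half after GEN 39 (files 79–82) is the
existence of WITNESSES at the odd layers: a zero-clause minus point of layer `k` not in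
`p·E(K_k) + E(K_{k−1})` (x1b GEN 39 note §3 (i)). The PAPER route reduces it, by `hsum`
(Prop. 8.12 ii), kernel) and pure algebra, to the following ANALYTIC statement, proved here:

* §1 `norm_le_norm_zeta_sub_one_of_norm_lt_one`: the value group of the layer is discrete —
  `x ∈ layer m`, `‖x‖ < 1 ⟹ ‖x‖ ≤ ‖ζ_m − 1‖` (`𝒪_m = ℤ_p[ζ_m − 1]`, orthogonality of the
  `π`-power basis; files PadicCyclotomicIntegers / PadicClosureCyclotomicTower).
* §2 uniform contraction on `L(m) ∩ E₁`: `‖z(p^j Q)‖ ≤ ρ_m^j`, `ρ_m = max ‖p‖ ‖ζ_m − 1‖ < 1`;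
  `‖Λ Q‖ = ‖z Q‖` below `1/2`; `Λ(L(m) ∩ E₁) ⊆ layer m`; `Λ(n • Q) = n Λ(Q)`.
* §3 **`mem_subfieldPoints_of_forall_exists_smul_add` (LAYER DESCENT)**: if `X ⊆ L(m) ∩ E₁`
  satisfies `X ⊆ p•X + (L(m') ∩ E₁)` (`m' ≤ m`) and `L(m)` has no `p`-power torsion (Prop. 8.7,
  kernel), then `X ⊆ L(m')`: iterating gives `x = p^j a_j + b_j`, so `Λ x` is within `ρ_m^j` of
  `layer m'`, which is closed (finite-dimensional over `ℚ_p`); hence `Λ x ∈ layer m'` and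
  `x ∈ L(m')` by the equivariance-plus-injectivity lemma `mem_subfieldPoints_of_ptLogΩ_mem`.
  ANY uniform contraction suffices — no structure of the logarithm lattice (Honda theory) is used.
* §4 `exists_mem_kernel_ptLogΩ_eq` (TEST POINTS): every `z ∈ layer m` with `‖z‖ ≤ 1/4` is `Λ Q`
  for some `Q ∈ L(m) ∩ E₁` (local surjectivity, file PadicBallLogSurj), and
  `act_eq_zsmul_of_smul_ptLogΩ_eq`: if `σ • Λ Q = u • Λ Q` (`u ∈ ℤ`) then `σ Q = u • Q` — so a
  point whose logarithm is an `η`-eigenvector IS an `η`-eigen point.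

HOW IT IS USED (next files; nothing of this is claimed here): at an odd layer `k`, if every
zero-clause minus point of `W(ℚ_k·ℚ_p)` lay in `p·W(ℚ_k·ℚ_p) + W(ℚ_{k−1}·ℚ_p)`, then (hsum + the
SignedTwist dictionary) the `η`-odd part `X` of `L(k+1) ∩ E₁` would satisfy the hypothesis of §3
with `m' = k`, so every `η`-odd point of `E₁(k_{k+1})` would be `k_k`-rational — contradicted by a
test point of §4 whose logarithm is `p^N·√p*·w`, `w ∈ ℚ_{k,p} ∖ k_k`.

References: [Kobayashi2003] S. Kobayashi, Invent. Math. 152 (2003), §8.4 (Prop. 8.7, Prop. 8.11,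
Prop. 8.12); [SilvermanAEC2009] IV.6.4 (the formal logarithm), VII.2.2; [SerreLocalFields1979]
Ch. IV §4 (`𝒪_m = ℤ_p[ζ − 1]`).
-/

noncomputable section

open scoped Classical Topology NNReal
open Filter PowerSeries Finset

namespace Summit.BirchSwinnertonDyer.Rank1Residual.Additive

namespace BallEval

open Literature.NumberTheory.GaloisRepresentations.LubinTate (unitBall mem_unitBall_iff)
open Literature.NumberTheory.EllipticCurves Literature.NumberTheory.EllipticCurves.FormalGroupChart
open WeierstrassCurve PadicCyclotomicTower Field

variable (p : ℕ) [hp : Fact p.Prime]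

/-! ## §1 The value group of the layer is discrete -/

/-- **Discreteness of the layer**: for `x ∈ layer m = ℚ_p(ζ_{p^m})` (`m ≥ 1`) with `‖x‖ < 1` one has
`‖x‖ ≤ ‖ζ_m − 1‖` (`x = ∑ r_j π^j` with `r_j ∈ ℤ_p`, `π = ζ_m − 1`; the constant term has norm `< 1`,
hence `≤ ‖p‖ = ‖π‖^{φ(p^m)} ≤ ‖π‖`). [cite: SerreLocalFields1979, Ch. IV §4] -/
theorem norm_le_norm_zeta_sub_one_of_norm_lt_one {m : ℕ} (hm : 1 ≤ m) {x : PadicAlgCl p}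
    (hx : x ∈ layer p m) (hx1 : ‖x‖ < 1) : ‖x‖ ≤ ‖zeta p m - 1‖ := by
  obtain ⟨r, hrdeg, hr, hrx⟩ := exists_intPoly_aeval_eq p hm hx hx1.le
  set π : PadicAlgCl p := zeta p m - 1 with hπ
  have hπ1 : ‖π‖ < 1 := norm_zeta_sub_one_lt_one p hm
  have hπ0 : 0 ≤ ‖π‖ := norm_nonneg _
  -- the constant coefficient
  have horth := norm_coeff_mul_le_norm_aeval p hm r hrdeg 0
  rw [pow_zero, mul_one, hrx] at horth
  have hc0 : ‖r.coeff 0‖ ≤ ‖π‖ := by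
    -- the values of `ℚ_p` are `p^ℤ`: `‖r₀‖ < 1 ⟹ ‖r₀‖ ≤ p⁻¹`
    have h1 : ‖r.coeff 0‖ ≤ (p : ℝ)⁻¹ := by
      have h := (Padic.norm_le_pow_iff_norm_lt_pow_add_one (r.coeff 0) (-1)).mpr
        (by simpa using horth.trans_lt hx1)
      simpa using h
    have h2 : (p : ℝ)⁻¹ ≤ ‖π‖ := by
      rw [← HondaFss.norm_natCast_p (p := p) (K := PadicAlgCl p), ← norm_zeta_sub_one_pow p hm]
      exact pow_le_of_le_one hπ0 hπ1.le (Nat.totient_pos.mpr (pow_pos hp.out.pos m)).ne'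
    exact h1.trans h2
  -- `x = r(0) + ∑_{j ≥ 1} r_j π^j`
  have hsum : x = algebraMap ℚ_[p] (PadicAlgCl p) (r.coeff 0) +
      ∑ j ∈ range r.natDegree, r.coeff (j + 1) • π ^ (j + 1) := by
    rw [← hrx, Polynomial.aeval_eq_sum_range, sum_range_succ', pow_zero, Algebra.smul_def, mul_one, add_comm]
  have htail : ‖∑ j ∈ range r.natDegree, r.coeff (j + 1) • π ^ (j + 1)‖ ≤ ‖π‖ := by
    refine IsUltrametricDist.norm_sum_le_of_forall_le_of_nonneg hπ0 fun j _ => ?_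
    rw [Algebra.smul_def, norm_mul, norm_algebraMap', norm_pow]
    calc ‖r.coeff (j + 1)‖ * ‖π‖ ^ (j + 1) ≤ 1 * ‖π‖ ^ (j + 1) :=
          mul_le_mul_of_nonneg_right (hr _) (pow_nonneg hπ0 _)
      _ = ‖π‖ ^ (j + 1) := one_mul _
      _ ≤ ‖π‖ := pow_le_of_le_one hπ0 hπ1.le (by omega)
  rw [hsum]
  refine (IsUltrametricDist.norm_add_le_max _ _).trans (max_le ?_ htail)
  rw [norm_algebraMap']; exact hc0

/-- The contraction ratio `ρ_m = max ‖p‖ ‖ζ_m − 1‖` is `< 1`. [folklore] -/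
theorem max_norm_p_norm_zeta_sub_one_lt_one {m : ℕ} (hm : 1 ≤ m) :
    max ‖(p : PadicAlgCl p)‖ ‖zeta p m - 1‖ < 1 :=
  max_lt (Literature.NumberTheory.GaloisRepresentations.PadicAlgCl.norm_natCast_prime_pos_lt_one
    (p := p)).2 (norm_zeta_sub_one_lt_one p hm)

/-! ## §2 Uniform contraction, the isometry and the layer of the logarithm on `L(m) ∩ E₁` -/

variable (M : WeierstrassCurve ℤ_[p]) [hE : (M.map PadicInt.Coe.ringHom).IsElliptic]

variable {p M}
variable [hintΩ : (genFibΩ p M).IsIntegral (Valued.v (R := PadicAlgCl p)).integer]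

omit hE in
/-- `‖z Q‖ < 1` on `E₁(Ω)`. [folklore] -/
theorem norm_zCoord_lt_one_of_mem_kernel {Q : (genFibΩ p M).toAffine.Point}
    (hk : Q ∈ kernel (Valued.v (R := PadicAlgCl p)) (genFibΩ p M)) : ‖Q.zCoord‖ < 1 := by
  have := val_zCoord_lt_one hk
  rwa [PadicAlgCl.valuation_def, ← NNReal.coe_lt_coe, coe_nnnorm, NNReal.coe_one] at this

omit hE hintΩ in
/-- `z Q ∈ layer m` for `Q ∈ L(m)`. [folklore] -/
theorem zCoord_mem_layer {m : ℕ} {Q : (genFibΩ p M).toAffine.Point}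
    (hQ : Q ∈ subfieldPoints (genFibΩ p M) (layer p m).toSubfield coeffs_mem_layer) :
    Q.zCoord ∈ layer p m := by
  obtain ⟨P, rfl⟩ := exists_toOmega_eq hQ
  rw [zCoord_toOmega]; exact LayerField.emb_mem _

omit hE in
/-- **Discreteness on points**: `‖z Q‖ ≤ ‖ζ_m − 1‖` for `Q ∈ L(m) ∩ E₁` (`m ≥ 1`).
[cite: SerreLocalFields1979, Ch. IV §4] -/
theorem norm_zCoord_le_norm_zeta_sub_one {m : ℕ} (hm : 1 ≤ m) {Q : (genFibΩ p M).toAffine.Point}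
    (hQ : Q ∈ subfieldPoints (genFibΩ p M) (layer p m).toSubfield coeffs_mem_layer)
    (hk : Q ∈ kernel (Valued.v (R := PadicAlgCl p)) (genFibΩ p M)) :
    ‖Q.zCoord‖ ≤ ‖zeta p m - 1‖ :=
  norm_le_norm_zeta_sub_one_of_norm_lt_one p hm (zCoord_mem_layer hQ) (norm_zCoord_lt_one_of_mem_kernel hk)

omit hE in
/-- `‖p‖` read in the layer field equals `‖p‖` in `Ω`. [folklore] -/
theorem norm_natCast_layerField (m : ℕ) : ‖(p : LayerField p m)‖ = ‖(p : PadicAlgCl p)‖ := by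
  rw [← LayerField.norm_emb, map_natCast]

omit hE in
/-- **Uniform contraction**: `‖z(p^j • Q)‖ ≤ ρ_m^j` for `Q ∈ L(m) ∩ E₁`, `ρ_m = max ‖p‖ ‖ζ_m − 1‖`.
[cite: SilvermanAEC2009, IV.6.4] [cite: Kobayashi2003, §8.4] -/
theorem norm_zCoord_pow_smul_le_pow {m : ℕ} (hm : 1 ≤ m) {Q : (genFibΩ p M).toAffine.Point}
    (hQ : Q ∈ subfieldPoints (genFibΩ p M) (layer p m).toSubfield coeffs_mem_layer)
    (hk : Q ∈ kernel (Valued.v (R := PadicAlgCl p)) (genFibΩ p M)) (j : ℕ) :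
    ‖(p ^ j • Q).zCoord‖ ≤ (max ‖(p : PadicAlgCl p)‖ ‖zeta p m - 1‖) ^ j := by
  haveI := isIntegral_curveK p (LayerField p m) M
  obtain ⟨P, rfl⟩ := exists_toOmega_eq hQ
  have hP : P ∈ kernel (NormedField.valuation (K := LayerField p m)) (curveK p (LayerField p m) M) :=
    (toOmega_mem_kernel_iff P).mp hk
  have hzP : ‖P.zCoord‖ = ‖(toOmega p M m P).zCoord‖ := by rw [zCoord_toOmega, LayerField.norm_emb]
  have hzle : ‖P.zCoord‖ ≤ ‖zeta p m - 1‖ := hzP ▸ norm_zCoord_le_norm_zeta_sub_one hm hQ hk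
  have hz1 : ‖P.zCoord‖ ≤ 1 := hzle.trans (norm_zeta_sub_one_le_one p m)
  have h := norm_zCoord_pow_smul_le hP j
  rw [← map_nsmul, zCoord_toOmega, LayerField.norm_emb]
  refine h.trans ?_
  have hmax0 : 0 ≤ max ‖(p : LayerField p m)‖ ‖P.zCoord‖ := le_max_of_le_left (norm_nonneg _)
  calc max ‖(p : LayerField p m)‖ ‖P.zCoord‖ ^ j * ‖P.zCoord‖
      ≤ max ‖(p : LayerField p m)‖ ‖P.zCoord‖ ^ j * 1 :=
        mul_le_mul_of_nonneg_left hz1 (pow_nonneg hmax0 _)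
    _ ≤ (max ‖(p : PadicAlgCl p)‖ ‖zeta p m - 1‖) ^ j := by
        rw [mul_one, norm_natCast_layerField]
        exact pow_le_pow_left₀ (le_max_of_le_left (norm_nonneg _)) (max_le_max le_rfl hzle) j

omit hE in
/-- **The isometry at depth, on `Ω`-points**: `‖Λ Q‖ = ‖z Q‖` for `Q ∈ L(m) ∩ E₁` with `‖z Q‖ < 1/2`.
[cite: SilvermanAEC2009, IV.6.4] -/
theorem norm_ptLogΩ_eq_of_lt_half {m : ℕ} {Q : (genFibΩ p M).toAffine.Point}
    (hQ : Q ∈ subfieldPoints (genFibΩ p M) (layer p m).toSubfield coeffs_mem_layer)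
    (hk : Q ∈ kernel (Valued.v (R := PadicAlgCl p)) (genFibΩ p M)) (hlt : ‖Q.zCoord‖ < 1 / 2) :
    ‖ptLogΩ p M Q‖ = ‖Q.zCoord‖ := by
  haveI := isIntegral_curveK p (LayerField p m) M
  obtain ⟨P, rfl⟩ := exists_toOmega_eq hQ
  have hP : P ∈ kernel (NormedField.valuation (K := LayerField p m)) (curveK p (LayerField p m) M) :=
    (toOmega_mem_kernel_iff P).mp hk
  rw [zCoord_toOmega, LayerField.norm_emb] at hlt ⊢
  rw [ptLogΩ_toOmega hP, LayerField.norm_emb, norm_ptLog_eq hlt]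

omit hE in
/-- **`Λ(L(m) ∩ E₁) ⊆ layer m`** (the series has coefficients in `ℚ_p` and converges in the complete
field `ℚ_p(ζ_{p^m})`). [cite: Kobayashi2003, §8.4] -/
theorem ptLogΩ_mem_layer {m : ℕ} {Q : (genFibΩ p M).toAffine.Point}
    (hQ : Q ∈ subfieldPoints (genFibΩ p M) (layer p m).toSubfield coeffs_mem_layer)
    (hk : Q ∈ kernel (Valued.v (R := PadicAlgCl p)) (genFibΩ p M)) : ptLogΩ p M Q ∈ layer p m := by
  haveI := isIntegral_curveK p (LayerField p m) M
  obtain ⟨P, rfl⟩ := exists_toOmega_eq hQ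
  have hP : P ∈ kernel (NormedField.valuation (K := LayerField p m)) (curveK p (LayerField p m) M) :=
    (toOmega_mem_kernel_iff P).mp hk
  rw [ptLogΩ_toOmega hP]; exact LayerField.emb_mem _

omit hintΩ in
/-- `Λ(−P) = −Λ(P)` on `E₁(K)`. [folklore] -/
theorem ptLog_neg {K : Type*} [NontriviallyNormedField K] [NormedAlgebra ℚ_[p] K] [IsUltrametricDist K]
    [CompleteSpace K] [(curveK p K M).IsIntegral (NormedField.valuation (K := K)).integer]
    {P : (curveK p K M).toAffine.Point} (hP : P ∈ kernel (NormedField.valuation (K := K)) (curveK p K M)) :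
    ptLog p K M (-P) = -ptLog p K M P := by
  have h := ptLog_add hP ((kernel (NormedField.valuation (K := K)) (curveK p K M)).neg_mem hP)
  rw [add_neg_cancel, ptLog_zero] at h
  linear_combination -h

omit hintΩ in
/-- `Λ(n • P) = n Λ(P)` on `E₁(K)` for `n ∈ ℤ`. [cite: SilvermanAEC2009, IV.6.4] -/
theorem ptLog_zsmul {K : Type*} [NontriviallyNormedField K] [NormedAlgebra ℚ_[p] K] [IsUltrametricDist K]
    [CompleteSpace K] [(curveK p K M).IsIntegral (NormedField.valuation (K := K)).integer]
    {P : (curveK p K M).toAffine.Point} (hP : P ∈ kernel (NormedField.valuation (K := K)) (curveK p K M))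
    (n : ℤ) : ptLog p K M (n • P) = n * ptLog p K M P := by
  cases n with
  | ofNat k => rw [Int.ofNat_eq_natCast, natCast_zsmul, ptLog_nsmul hP k, Int.cast_natCast]
  | negSucc k =>
    rw [negSucc_zsmul, ptLog_neg ((kernel (NormedField.valuation (K := K)) (curveK p K M)).nsmul_mem hP _),
      ptLog_nsmul hP (k + 1), Int.cast_negSucc, neg_mul]

/-- **`Λ(n • Q) = n Λ(Q)`** on `L(m) ∩ E₁`, `n ∈ ℤ`. [cite: SilvermanAEC2009, IV.6.4] -/
theorem ptLogΩ_zsmul {m : ℕ} {Q : (genFibΩ p M).toAffine.Point}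
    (hQ : Q ∈ subfieldPoints (genFibΩ p M) (layer p m).toSubfield coeffs_mem_layer)
    (hk : Q ∈ kernel (Valued.v (R := PadicAlgCl p)) (genFibΩ p M)) (n : ℤ) :
    ptLogΩ p M (n • Q) = n * ptLogΩ p M Q := by
  haveI := isIntegral_curveK p (LayerField p m) M
  obtain ⟨P, rfl⟩ := exists_toOmega_eq hQ
  have hP : P ∈ kernel (NormedField.valuation (K := LayerField p m)) (curveK p (LayerField p m) M) :=
    (toOmega_mem_kernel_iff P).mp hk
  rw [← map_zsmul, ptLogΩ_toOmega hP,
    ptLogΩ_toOmega ((kernel (NormedField.valuation (K := LayerField p m)) (curveK p (LayerField p m) M)).zsmul_mem hP n),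
    ptLog_zsmul hP n, map_mul, map_intCast]

/-- `Λ(n • Q) = n Λ(Q)` on `L(m) ∩ E₁`, `n ∈ ℕ`. [cite: SilvermanAEC2009, IV.6.4] -/
theorem ptLogΩ_nsmul {m : ℕ} {Q : (genFibΩ p M).toAffine.Point}
    (hQ : Q ∈ subfieldPoints (genFibΩ p M) (layer p m).toSubfield coeffs_mem_layer)
    (hk : Q ∈ kernel (Valued.v (R := PadicAlgCl p)) (genFibΩ p M)) (n : ℕ) :
    ptLogΩ p M (n • Q) = n * ptLogΩ p M Q := by
  have h := ptLogΩ_zsmul hQ hk (n : ℤ)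
  rwa [natCast_zsmul, Int.cast_natCast] at h

/-! ## §3 Layer descent -/

omit hE hintΩ in
/-- `layer m'` is closed in `Ω` (a finite-dimensional `ℚ_p`-subspace). [folklore] -/
theorem isClosed_layer (m' : ℕ) : IsClosed ((layer p m' : IntermediateField ℚ_[p] (PadicAlgCl p)) : Set (PadicAlgCl p)) := by
  haveI : FiniteDimensional ℚ_[p] (layer p m') := finiteDimensional_layer p m'
  haveI : FiniteDimensional ℚ_[p] (Subalgebra.toSubmodule (layer p m').toSubalgebra) :=
    (inferInstance : FiniteDimensional ℚ_[p] (layer p m'))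
  exact Submodule.closed_of_finiteDimensional (Subalgebra.toSubmodule (layer p m').toSubalgebra)

omit hp hE hintΩ in
/-- Iterating `X ⊆ p•X + B` (`B` a subgroup): `X ⊆ p^j•X + B` for every `j`. [folklore] -/
theorem exists_pow_smul_add_of_forall_exists_smul_add {A : Type*} [AddCommGroup A] (X : Set A)
    (B : AddSubgroup A) (hstep : ∀ x ∈ X, ∃ a ∈ X, ∃ b ∈ B, x = p • a + b) (j : ℕ) :
    ∀ x ∈ X, ∃ a ∈ X, ∃ b ∈ B, x = p ^ j • a + b := by
  induction j with
  | zero => exact fun x hx => ⟨x, hx, 0, B.zero_mem, by rw [pow_zero, one_smul, add_zero]⟩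
  | succ j ih =>
    intro x hx
    obtain ⟨a, ha, b, hb, rfl⟩ := ih x hx
    obtain ⟨a', ha', b', hb', rfl⟩ := hstep a ha
    refine ⟨a', ha', p ^ j • b' + b, B.add_mem (B.nsmul_mem hb' _) hb, ?_⟩
    rw [smul_add, ← mul_smul, ← pow_succ, add_assoc]

/-- **LAYER DESCENT.** Let `X ⊆ L(m) ∩ E₁` (`m ≥ 1`, `m' ≤ m`) with `X ⊆ p•X + (L(m') ∩ E₁)`, and let
`L(m)` have no `p`-power torsion (Prop. 8.7). Then `X ⊆ L(m')`: writing `x = p^j a_j + b_j`,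
`Λ x − Λ b_j = Λ(p^j a_j)` has norm `≤ ρ_m^j → 0` with `Λ b_j ∈ layer m'` closed, so
`Λ x ∈ layer m'`, and a point of `L(m) ∩ E₁` with logarithm in `layer m'` lies in `L(m')`
(`mem_subfieldPoints_of_ptLogΩ_mem`). `act` is any coordinatewise Galois action on `E_Ω`-points.
[cite: Kobayashi2003, §8.4 (Prop. 8.7, Prop. 8.12)] [cite: SilvermanAEC2009, IV.6.4] -/
theorem mem_subfieldPoints_of_forall_exists_smul_add
    (act : absoluteGaloisGroup ℚ_[p] → (genFibΩ p M).toAffine.Point → (genFibΩ p M).toAffine.Point)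
    (hact0 : ∀ σ, act σ 0 = 0)
    (hact : ∀ σ (x y : PadicAlgCl p) (h : (genFibΩ p M).toAffine.Nonsingular x y),
      ∃ h', act σ (Affine.Point.some x y h) = Affine.Point.some (σ • x) (σ • y) h')
    {m m' : ℕ} (hm : 1 ≤ m) (hm' : m' ≤ m)
    (htors : ∀ Q ∈ subfieldPoints (genFibΩ p M) (layer p m).toSubfield coeffs_mem_layer,
      ∀ k : ℕ, p ^ k • Q = 0 → Q = 0)
    (X : Set (genFibΩ p M).toAffine.Point)
    (hXL : ∀ x ∈ X, x ∈ subfieldPoints (genFibΩ p M) (layer p m).toSubfield coeffs_mem_layer)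
    (hXk : ∀ x ∈ X, x ∈ kernel (Valued.v (R := PadicAlgCl p)) (genFibΩ p M))
    (hstep : ∀ x ∈ X, ∃ a ∈ X,
      ∃ b ∈ subfieldPoints (genFibΩ p M) (layer p m').toSubfield coeffs_mem_layer ⊓
        kernel (Valued.v (R := PadicAlgCl p)) (genFibΩ p M), x = p • a + b)
    {x : (genFibΩ p M).toAffine.Point} (hx : x ∈ X) :
    x ∈ subfieldPoints (genFibΩ p M) (layer p m').toSubfield coeffs_mem_layer := by
  haveI := isIntegral_curveK p (LayerField p m) M
  set L := subfieldPoints (genFibΩ p M) (layer p m).toSubfield coeffs_mem_layer with hLdef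
  set L' := subfieldPoints (genFibΩ p M) (layer p m').toSubfield coeffs_mem_layer with hL'def
  set E₁ := kernel (Valued.v (R := PadicAlgCl p)) (genFibΩ p M) with hE₁def
  set ρ : ℝ := max ‖(p : PadicAlgCl p)‖ ‖zeta p m - 1‖ with hρ
  have hρ1 : ρ < 1 := max_norm_p_norm_zeta_sub_one_lt_one p hm
  have hρ0 : 0 ≤ ρ := le_max_of_le_left (norm_nonneg _)
  have hL'L : L' ≤ L := subfieldPoints_layer_mono hm'
  -- `Λ x` is in the closure of `layer m'`
  have hclos : ptLogΩ p M x ∈ closure ((layer p m' : IntermediateField ℚ_[p] (PadicAlgCl p)) : Set (PadicAlgCl p)) := by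
    rw [Metric.mem_closure_iff]
    intro ε hε
    obtain ⟨j, hj⟩ : ∃ j : ℕ, ρ ^ j < min ε (1 / 2) := exists_pow_lt_of_lt_one (lt_min hε (by norm_num)) hρ1
    obtain ⟨a, ha, b, hb, hxab⟩ := exists_pow_smul_add_of_forall_exists_smul_add X (L' ⊓ E₁) hstep j x hx
    obtain ⟨hbL', hbk⟩ := AddSubgroup.mem_inf.mp hb
    refine ⟨ptLogΩ p M b, ptLogΩ_mem_layer hbL' hbk, ?_⟩
    have haj : p ^ j • a ∈ L := L.nsmul_mem (hXL a ha) _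
    have hajk : p ^ j • a ∈ E₁ := E₁.nsmul_mem (hXk a ha) _
    have hΛ : ptLogΩ p M x - ptLogΩ p M b = ptLogΩ p M (p ^ j • a) := by
      rw [hxab, ptLogΩ_add (m := m) haj (hL'L hbL') hajk hbk, add_sub_cancel_right]
    have hz : ‖(p ^ j • a).zCoord‖ ≤ ρ ^ j := norm_zCoord_pow_smul_le_pow hm (hXL a ha) (hXk a ha) j
    have hzlt : ‖(p ^ j • a).zCoord‖ < 1 / 2 := hz.trans_lt (hj.trans_le (min_le_right _ _))
    rw [dist_eq_norm, hΛ, norm_ptLogΩ_eq_of_lt_half haj hajk hzlt]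
    exact hz.trans_lt (hj.trans_le (min_le_left _ _))
  rw [(isClosed_layer m').closure_eq] at hclos
  exact mem_subfieldPoints_of_ptLogΩ_mem act hact0 hact htors (hXL x hx) (hXk x hx) hclos

/-! ## §4 Test points: prescribed logarithm and eigen-transfer -/

/-- **Test points**: every `z ∈ layer m` with `‖z‖ ≤ 1/4` is the logarithm of a point of
`L(m) ∩ E₁` (local surjectivity of `Λ` on `E₁(ℚ_p(ζ_{p^m}))`, transported to `Ω`).
[cite: SilvermanAEC2009, IV.6.4] -/
theorem exists_mem_kernel_ptLogΩ_eq {m : ℕ} {z : PadicAlgCl p} (hz : z ∈ layer p m) (hz4 : ‖z‖ ≤ 1 / 4) :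
    ∃ Q ∈ subfieldPoints (genFibΩ p M) (layer p m).toSubfield coeffs_mem_layer,
      Q ∈ kernel (Valued.v (R := PadicAlgCl p)) (genFibΩ p M) ∧ ptLogΩ p M Q = z := by
  haveI := isIntegral_curveK p (LayerField p m) M
  set y : LayerField p m := LayerField.mk p m z hz with hy
  have hy4 : ‖y‖ ≤ 1 / 4 := by rw [← LayerField.norm_emb, hy, LayerField.emb_mk]; exact hz4
  obtain ⟨P, hP, hPy, -⟩ := exists_ptLog_eq (p := p) (K := LayerField p m) (M := M) hy4
  refine ⟨toOmega p M m P, toOmega_mem_subfieldPoints P, (toOmega_mem_kernel_iff P).mpr hP, ?_⟩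
  rw [ptLogΩ_toOmega hP, hPy, hy, LayerField.emb_mk]

/-- **Eigen-transfer**: for `Q ∈ L(m) ∩ E₁` (`L(m)` without `p`-power torsion) and `σ ∈ Γ_{ℚ_p}`
with `σ • Λ Q = u • Λ Q` (`u ∈ ℤ`), `act σ Q = u • Q`: both sides lie in `L(m) ∩ E₁` and have the
same logarithm, so their difference is `p`-power torsion. In particular a point whose logarithm
is an `η`-eigenvector for a `±1`-valued character is an `η`-eigen point. [cite: Kobayashi2003, §8.4] -/
theorem act_eq_zsmul_of_smul_ptLogΩ_eq
    (act : absoluteGaloisGroup ℚ_[p] → (genFibΩ p M).toAffine.Point → (genFibΩ p M).toAffine.Point)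
    (hact0 : ∀ σ, act σ 0 = 0)
    (hact : ∀ σ (x y : PadicAlgCl p) (h : (genFibΩ p M).toAffine.Nonsingular x y),
      ∃ h', act σ (Affine.Point.some x y h) = Affine.Point.some (σ • x) (σ • y) h')
    {m : ℕ}
    (htors : ∀ Q ∈ subfieldPoints (genFibΩ p M) (layer p m).toSubfield coeffs_mem_layer,
      ∀ k : ℕ, p ^ k • Q = 0 → Q = 0)
    {Q : (genFibΩ p M).toAffine.Point}
    (hQ : Q ∈ subfieldPoints (genFibΩ p M) (layer p m).toSubfield coeffs_mem_layer)
    (hk : Q ∈ kernel (Valued.v (R := PadicAlgCl p)) (genFibΩ p M))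
    (σ : absoluteGaloisGroup ℚ_[p]) (u : ℤ) (hσ : σ • ptLogΩ p M Q = u • ptLogΩ p M Q) :
    act σ Q = u • Q := by
  haveI := isIntegral_curveK p (LayerField p m) M
  set L := subfieldPoints (genFibΩ p M) (layer p m).toSubfield coeffs_mem_layer with hLdef
  set E₁ := kernel (Valued.v (R := PadicAlgCl p)) (genFibΩ p M) with hE₁def
  have h1L : act σ Q ∈ L := act_mem_subfieldPoints act hact0 hact σ hQ
  have h1k : act σ Q ∈ E₁ := act_mem_kernel act hact0 hact σ hk
  have h2L : u • Q ∈ L := L.zsmul_mem hQ u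
  have h2k : u • Q ∈ E₁ := E₁.zsmul_mem hk u
  have hDL : act σ Q - u • Q ∈ L := L.sub_mem h1L h2L
  have hDk : act σ Q - u • Q ∈ E₁ := E₁.sub_mem h1k h2k
  have hΛ : ptLogΩ p M (act σ Q - u • Q) = 0 := by
    rw [ptLogΩ_sub (m := m) h1L h2L h1k h2k, ptLogΩ_act act hact0 hact σ (norm_zCoord_lt_one_of_mem_kernel hk),
      hσ, ptLogΩ_zsmul hQ hk u, zsmul_eq_mul, sub_self]
  obtain ⟨k, hk0⟩ := exists_pow_smul_eq_zero_of_ptLogΩ_eq_zero (m := m) hDL hDk hΛ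
  exact sub_eq_zero.mp (htors _ hDL k hk0)

end BallEval

end Summit.BirchSwinnertonDyer.Rank1Residual.Additive

end
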